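import Literature.AlgebraicGeometry.Resolution.ProperModelsPatching
import Literature.AlgebraicGeometry.Resolution.BlowupsIntegral
import Literature.AlgebraicGeometry.Resolution.BlowupsExistence
import Literature.AlgebraicGeometry.Resolution.BlowupsFlatBaseChange
import Literature.AlgebraicGeometry.Resolution.QuasiExcellentSchemes
import HarnessLib

/-!
# The sandwiched-resolution statement contains the strong resolution of every blow-up of a
# regular variety, hence Piltant's principalization axiom on regular varieties

Topic: `Literature/AlgebraicGeometry/Resolution`. `SandwichedStrongResolution p`
(`ProperModelsPatching.lean`; Cossart–Piltant 2019, Thm. 1.1 (i)–(ii) shape, OPEN in dimension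
`≥ 4`) asks for a resolution which is an isomorphism over `Reg V` of every integral `V` proper and
birational over a regular integral separated `k`-scheme of finite type `U`, `char k = p`. Two
PROVED specializations, recording what the statement demands (cdisprove gen 5 on crux
stmt-ResolutionOfSingularities-0642, §11 of `Cruxes/PatchingRel/Disproof.lean`):

* `sandwichedStrongResolution_blowup` — for every ideal sheaf `J ≠ ⊥` on such a `U` and every
  blowing up `π : V → U` along `J` (blow-ups exist, `exists_isBlowup`; are integral and birational,
  `IsBlowup.isIntegral` / `isBirational'`; and proper modulo the named fact `Stacks02NS`), `V`
  has a resolution which is an isomorphism over `Reg V`. E.g. `U = 𝔸ⁿ⁺¹`, `J = (x₁ᵖ, g(x'))`: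
  the chart `D₊(x₁ᵖ t)` of `Bl_J 𝔸ⁿ⁺¹` is the hypersurface `x₁ᵖ t = g(x₂, …, x_{n+1})`
  (Stacks 0BIQ), whose germs `x₁ᵖ (t₀ + s) = g(x')` (`t₀ ≠ 0`) are Frobenius-twisted pencils of
  the purely inseparable germ `wᵖ = g(x')`; so in dimension `4` the statement already asks for
  strong resolution of fourfolds fibred in arbitrary Zariski threefold germs, beyond
  Cossart–Piltant 2019.
* `sandwichedStrongResolution_principalization` — Piltant's Axiom 4 (Piltant 2013, p. 4:
  principalization `π : X̃ → X` with `π⁻¹(Reg X) ⊆ Reg X̃` and `π` an isomorphism over the locus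
  where the ideal is already principal) ON REGULAR `X = U`, in every dimension, in the shape "a
  regular modification `Y → V → U` through the blowing up of `J`, an isomorphism over
  `U ∖ V(J)`": compose the blow-up with the strong resolution above; over the complement of the
  centre the blow-up restricts to an isomorphism onto an open of the regular `U`
  (`IsBlowup.isIso_compl`), so those points are regular points of `V`
  (`mem_regularLocus_iff_of_isIso_morphismRestrict`), over which the resolution is an
  isomorphism.

## References

* O. Piltant, *An axiomatic version of Zariski's patching theorem*, RACSAM 107 (2013) 91–121,
  Axiom 4 p. 4 and p. 2. [Piltant2013]
* V. Cossart, O. Piltant, J. Algebra 529 (2019), Thm. 1.1. [CossartPiltant2019]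
* The Stacks Project, Tags 02ND, 02OS, 02NS, 0BIQ. [StacksProject]
-/

noncomputable section

open CategoryTheory AlgebraicGeometry TopologicalSpace

namespace Literature.AlgebraicGeometry.Resolution

universe u

/-- **`SandwichedStrongResolution p` resolves every blow-up of a regular variety, strongly**:
under properness of blow-ups (`Stacks02NS`), for every regular integral separated `k`-scheme of
finite type `U` over a field of characteristic `p`, every ideal sheaf `J ≠ ⊥` and every blowing up
`π : V → U` of `U` along `J`, there is a resolution of `V` which is an isomorphism over `Reg V`.
[cite: CossartPiltant2019, Thm. 1.1 (i)-(ii) shape; specialization to blow-ups, folklore] -/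
theorem sandwichedStrongResolution_blowup {p : ℕ} (hS : SandwichedStrongResolution.{u} p)
    (h02 : Stacks02NS.{u}) (k : Type u) [Field k] [CharP k p] (U : Scheme.{u})
    (f : U ⟶ Spec (.of k)) [IsSeparated f] [LocallyOfFiniteType f] [QuasiCompact f]
    [IsIntegral U] (hU : Scheme.IsRegular U) (J : U.IdealSheafData) (hJ : J ≠ ⊥)
    {V : Scheme.{u}} (π : V ⟶ U) (hπ : IsBlowup π J) :
    ∃ (Y : Scheme.{u}) (ρ : Y ⟶ V), IsResolution ρ ∧
      ∃ W : V.Opens, (W : Set V) = Scheme.regularLocus V ∧ IsIso (ρ ∣_ W) := by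
  haveI : IsIntegral V := hπ.isIntegral hJ
  haveI : IsNoetherian U := Scheme.isNoetherian_of_finiteType_over_field f
  haveI : IsProper π := h02.of_isLocallyNoetherian π J hπ
  exact hS k U V f π inferInstance inferInstance inferInstance inferInstance hU inferInstance
    inferInstance (hπ.isBirational' hJ)

/-- **`SandwichedStrongResolution p` gives Piltant's Axiom 4 on regular varieties** (all
dimensions; Piltant 2013, Axiom 4, p. 4, case `X` regular): for `U` as above and `J ≠ ⊥` there
are a blowing up `π : V → U` of `J` and a resolution `ρ : Y → V` — so `Y` is regular, `ρ ≫ π` is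
proper and `J·𝒪_Y` is the pull-back of the effective Cartier divisor `J·𝒪_V` — with `ρ` an
isomorphism over an open `W = Reg V` containing `π⁻¹(U ∖ V(J))`, over which `π` is itself an
isomorphism. [cite: Piltant2013, Axiom 4 p. 4 (shape, X regular)] -/
theorem sandwichedStrongResolution_principalization {p : ℕ}
    (hS : SandwichedStrongResolution.{u} p) (h02 : Stacks02NS.{u}) (k : Type u) [Field k]
    [CharP k p] (U : Scheme.{u}) (f : U ⟶ Spec (.of k)) [IsSeparated f] [LocallyOfFiniteType f]
    [QuasiCompact f] [IsIntegral U] (hU : Scheme.IsRegular U) (J : U.IdealSheafData)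
    (hJ : J ≠ ⊥) :
    ∃ (V Y : Scheme.{u}) (π : V ⟶ U) (ρ : Y ⟶ V), IsBlowup π J ∧ IsResolution ρ ∧
      Scheme.IsRegular Y ∧ IsProper (ρ ≫ π) ∧
      ∃ W : V.Opens, (W : Set V) = Scheme.regularLocus V ∧ IsIso (ρ ∣_ W) ∧
        π ⁻¹ᵁ (centreCompl J) ≤ W ∧ IsIso (π ∣_ centreCompl J) := by
  obtain ⟨V, π, hπ⟩ := exists_isBlowup U J
  obtain ⟨Y, ρ, hρ, W, hW, hiso⟩ := sandwichedStrongResolution_blowup hS h02 k U f hU J hJ π hπ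
  haveI : IsNoetherian U := Scheme.isNoetherian_of_finiteType_over_field f
  haveI : IsProper π := h02.of_isLocallyNoetherian π J hπ
  haveI : IsProper ρ := hρ.isProper
  haveI hc : IsIso (π ∣_ centreCompl J) := hπ.isIso_compl
  refine ⟨V, Y, π, ρ, hπ, hρ, hρ.isRegular, inferInstance, W, hW, hiso, ?_, hc⟩
  intro v hv
  have hvW : v ∈ (W : Set V) := by
    rw [hW, mem_regularLocus_iff_of_isIso_morphismRestrict π (centreCompl J) v hv,
      hU.regularLocus_eq_univ]
    trivial
  exact hvW

end Literature.AlgebraicGeometry.Resolution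

end
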